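import Summits.Parity.GeneralizedHardyLittlewood.Theorems.BeyondDiagonalBeatsQuarter.OffDiagCoreWinBlockIntegral
import Summits.Parity.GeneralizedHardyLittlewood.Theorems.BeyondDiagonalBeatsQuarter.OffDiagCoreWinBlockFamily
import HarnessLib

/-!
# Route `PrimeLevelFamEdge`, crux K_B (stmt-Parity-20343), line `diagonal_kernel_split` rev 4, plan Ω,
# node **L7d part 2, leaf G6 — the whole windowed FL-family bounded by the sum over (block, k, w) of the τ-free
# aggregate expressions** (L7D-PLAN rev 7 §7: G2a `coreWin_eq_sum_blocks_integral_family` + G5 `norm_integral_blockFamily_le`)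

* **`abs_coreWin_largeKernel_le`** — `|coreWin (D·K_L) T G (2N) N (coreHeight ε₀) Δ′| ≤ Σ_{b ≤ Λ} Σ_{k < 2N+1} Σ_{w ∈ 3×3} (9/4)·B_{b,k,w}`.

After this file the hypothesis `hwin` of `hFL_of_coreWin_funded` (REDUCTION) is EXACTLY: for the chosen selector `D` (which must
give `hDH`, `hDρ`), `Σ_{b,k,w} (9/4)·B_{b,k,w} ≤ ε·Σ_{q ∈ goodPrimes Δ′ N} ms(q)` eventually — the aggregate fibre sup (D6 +
`card_active_le`) and the currency (L7D-PLAN rev 7 §7 G4b/$).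
Pure inequality bookkeeping; standard axioms. Helper toward `stub_offDiagBelowSlack_io`; closes nothing.
«The programme SEARCHES and TYPES; no claim about Landau–Siegel zeros, Theorems 1–2 of arXiv:2211.02515 or
a repaired Margin232 until a kernel theorem says so.»
-/

noncomputable section

open Finset Real Complex MeasureTheory Polynomial
open scoped Nat

namespace Summit.Parity.GeneralizedHardyLittlewood.Theorems.BeyondDiagonalBeatsQuarter.OffDiag

open Literature.Analysis.FunctionSpaces (besselJ)
open Literature.Analysis.Calculus.WhitneyConvex (dyadicBump)
open Literature.NumberTheory.LFunctions Literature.NumberTheory.LFunctions.KMV2000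
open Literature.NumberTheory.Sieve.FriedlanderIwaniecPrimes (fourier2 ker)
open Literature.NumberTheory.Sieve.LargeSieve (e sepCoeff sepWeight)
open PeterssonSplit (nearBoxes)

open Classical in
/-- **The whole windowed FL-family, bounded.** Hypotheses: `1 ≤ R`, `1 ≤ N`, `H_D ≤ N`, `1 ≤ L ≤ N`, levels `G` prime, `≥ 40`,
in `(N, 2N]`, covered by the blocks `b ≤ Λ`; `0 < Δ′`, `0 ≤ ε₀`, `J ≥ 1`; selector `D` with `|h₁| ≤ H_D` and the Taylor condition on
every block for its selected members. [cite: KowalskiMichelVanderKam2000, §6 p. 19 — derivation; Davenport1980, ch. 29 — derivation] -/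
theorem abs_coreWin_largeKernel_le (R : ℕ) (hR : 1 ≤ R) {D : ℕ → ℕ → ℕ → ℕ → ℕ → ℕ × ℕ → ℤ → ℤ → ℂ} {N H_D : ℕ} (hN : 1 ≤ N)
    (hH : H_D ≤ N) (T : ℕ → ℕ → ℕ → ℕ → ℕ → ℕ × ℕ → ℤ → ℕ) (G : Finset ℕ) {L : ℕ} (hL : 1 ≤ L) (hLN : L ≤ N)
    {Λ : ℕ} (hG : ∀ q ∈ G, q.Prime ∧ 40 ≤ q ∧ N < q ∧ q ≤ N + Λ * L ∧ q ≤ 2 * N) {Δ' : ℝ} (hΔ : 0 < Δ') {ε₀ : ℝ} (hε₀ : 0 ≤ ε₀)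
    {J : ℕ} (hJ : 1 ≤ J)
    (hDH : ∀ r l m d₁ d₂ i h₁ s, D r l m d₁ d₂ i h₁ s ≠ 0 → |h₁| ≤ (H_D : ℤ))
    (hDρ : ∀ b ∈ Finset.range (Λ + 1), ∀ x ∈ memberSet G (2 * N) N (coreHeight ε₀) T Δ', D x.r x.l x.m x.d₁ x.d₂ x.i x.h₁ x.s ≠ 0 →
      (((N + b * L : ℕ) : ℝ))⁻¹ - (((N + b * L + (L - 1) + 1 : ℕ) : ℝ))⁻¹ ≤
        (((N + b * L + (L - 1) + 1 : ℕ) : ℝ))⁻¹ / (1 + 2 * (4 * π * Real.sqrt (((x.l / x.d₁ : ℕ) : ℝ) * (x.m / x.d₂ : ℕ) *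
            (2 * 2 ^ x.i.1) * (2 * 2 ^ x.i.2)) / ((x.r + 1 : ℕ) : ℝ)) * (((N + b * L + (L - 1) + 1 : ℕ) : ℝ))⁻¹ +
          4 * π * (2 * 2 ^ x.i.1 * |(x.h₁ : ℝ) / (x.r + 1)| +
            2 * 2 ^ x.i.2 * |((((x.l / x.d₁ : ℕ) : ℤ) * (x.m / x.d₂ : ℕ) : ℝ)) / ((x.h₁ : ℝ) * (x.r + 1))|) *
            (((N + b * L + (L - 1) + 1 : ℕ) : ℝ))⁻¹) / 2) :
    |coreWin (fun q r l m d₁ d₂ i h₁ s ↦ D r l m d₁ d₂ i h₁ s *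
        levelLargePart R {q} (fun _ ↦ (1 : ℂ)) (switchMod (r + 1) s h₁)
          (switchClass (r + 1) (((l / d₁ : ℕ) : ℤ) * (m / d₂ : ℕ)) s h₁)) T G (2 * N) N (coreHeight ε₀) Δ'| ≤
      ∑ b ∈ Finset.range (Λ + 1), ∑ k ∈ Finset.range (2 * N + 1), ∑ w ∈ Finset.range 3 ×ˢ Finset.range 3,
        3 / 2 * (3 / 2 * ((∑ j ∈ Finset.range J, (1 / 2 : ℝ) ^ j *
          Real.sqrt (∑ q ∈ G.filter (fun q ↦ (q - N) / L = b),
            ‖(e ((k : ℝ) * q / (2 * N + 1 : ℕ)) * (2 * (qhat q : ℂ) * (2 * π / q)) *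
                (((Real.log (qhat q ^ Δ'))⁻¹ ^ (w.1 + w.2) : ℝ) : ℂ)) *
              ((((((q : ℝ))⁻¹ - (((N + b * L + (L - 1) + 1 : ℕ) : ℝ))⁻¹) /
                ((((N + b * L : ℕ) : ℝ))⁻¹ - (((N + b * L + (L - 1) + 1 : ℕ) : ℝ))⁻¹)) ^ j : ℝ) : ℂ)‖ ^ 2)) *
        (Real.sqrt (∑ h ∈ Finset.Icc 1 H_D, ∑ c' ∈ (Finset.range h).filter (fun c' ↦ c'.Coprime h),
            (∑ x ∈ ((memberSet G (2 * N) N (coreHeight ε₀) T Δ').filter (fun x ↦ x.h₁ ≠ 0 ∧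
                (((switchGcd (x.r + 1) x.s x.h₁ : ℤ) ∣ ((x.l / x.d₁ : ℕ) : ℤ) * (x.m / x.d₂ : ℕ) ∧
                  IsUnit (switchClass (x.r + 1) (((x.l / x.d₁ : ℕ) : ℤ) * (x.m / x.d₂ : ℕ)) x.s x.h₁))) ∧
                D x.r x.l x.m x.d₁ x.d₂ x.i x.h₁ x.s ≠ 0)).filter
                (fun x ↦ switchMod (x.r + 1) x.s x.h₁ = h ∧
                  (switchClass (x.r + 1) (((x.l / x.d₁ : ℕ) : ℤ) * (x.m / x.d₂ : ℕ)) x.s x.h₁).val = c'),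
              ‖((if Nat.Coprime (x.l / x.d₁) (x.r + 1) then (1 : ℂ) else 0) *
                  ((if IsUnit ((x.h₁ : ℤ) : ZMod (x.r + 1)) ∧ x.h₁ ≠ 0 then (1 : ℂ) else 0) *
                    (if ((switchGcd (x.r + 1) x.s x.h₁ : ℤ) ∣ ((x.l / x.d₁ : ℕ) : ℤ) * (x.m / x.d₂ : ℕ) ∧
                        IsUnit (switchClass (x.r + 1) (((x.l / x.d₁ : ℕ) : ℤ) * (x.m / x.d₂ : ℕ)) x.s x.h₁)) then (1 : ℂ) else 0) *
                    D x.r x.l x.m x.d₁ x.d₂ x.i x.h₁ x.s) *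
                  convexCoeff (fun q ↦ (coreRange Δ' ε₀ x.r x.l x.m x.d₁ x.d₂ x.i x.h₁ q ∧
                      ¬ ((T x.r x.l x.m x.d₁ x.d₂ x.i x.h₁ : ℝ) <
                        |(x.s : ℝ) + ((((x.l / x.d₁ : ℕ) : ℤ) * (x.m / x.d₂ : ℕ) : ℤ) : ℝ) / ((q * (x.r + 1) : ℕ) : ℝ)|)) ∧
                      (N + b * L ≤ q ∧ q ≤ N + b * L + (L - 1))) (2 * N + 1) k *
                  ((trinomCoeff x.l w.1 * trinomCoeff x.m w.2 : ℝ) : ℂ) *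
                  (((2 : ℝ) ^ x.i.1 * 2 ^ x.i.2 : ℝ) : ℂ))‖ *
                (((x.d₁ : ℝ) * (2 ^ x.i.1 * (1 / 2)) * ((x.d₂ : ℝ) * (2 ^ x.i.2 * (1 / 2)))) ^ (-(1 / 2 : ℝ)) *
                  (((x.r + 1 : ℕ) : ℝ))⁻¹)) ^ 2) *
          ((1 + Real.log H_D) * Real.sqrt (2 * ((N : ℝ) + 1) / R + 4 * H_D))) +
        J * (1 / 2) ^ J * (∑ x ∈ (memberSet G (2 * N) N (coreHeight ε₀) T Δ').filter (fun x ↦ x.h₁ ≠ 0 ∧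
                (((switchGcd (x.r + 1) x.s x.h₁ : ℤ) ∣ ((x.l / x.d₁ : ℕ) : ℤ) * (x.m / x.d₂ : ℕ) ∧
                  IsUnit (switchClass (x.r + 1) (((x.l / x.d₁ : ℕ) : ℤ) * (x.m / x.d₂ : ℕ)) x.s x.h₁))) ∧
                D x.r x.l x.m x.d₁ x.d₂ x.i x.h₁ x.s ≠ 0),
              ‖((if Nat.Coprime (x.l / x.d₁) (x.r + 1) then (1 : ℂ) else 0) *
                  ((if IsUnit ((x.h₁ : ℤ) : ZMod (x.r + 1)) ∧ x.h₁ ≠ 0 then (1 : ℂ) else 0) *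
                    (if ((switchGcd (x.r + 1) x.s x.h₁ : ℤ) ∣ ((x.l / x.d₁ : ℕ) : ℤ) * (x.m / x.d₂ : ℕ) ∧
                        IsUnit (switchClass (x.r + 1) (((x.l / x.d₁ : ℕ) : ℤ) * (x.m / x.d₂ : ℕ)) x.s x.h₁)) then (1 : ℂ) else 0) *
                    D x.r x.l x.m x.d₁ x.d₂ x.i x.h₁ x.s) *
                  convexCoeff (fun q ↦ (coreRange Δ' ε₀ x.r x.l x.m x.d₁ x.d₂ x.i x.h₁ q ∧
                      ¬ ((T x.r x.l x.m x.d₁ x.d₂ x.i x.h₁ : ℝ) <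
                        |(x.s : ℝ) + ((((x.l / x.d₁ : ℕ) : ℤ) * (x.m / x.d₂ : ℕ) : ℤ) : ℝ) / ((q * (x.r + 1) : ℕ) : ℝ)|)) ∧
                      (N + b * L ≤ q ∧ q ≤ N + b * L + (L - 1))) (2 * N + 1) k *
                  ((trinomCoeff x.l w.1 * trinomCoeff x.m w.2 : ℝ) : ℂ) *
                  (((2 : ℝ) ^ x.i.1 * 2 ^ x.i.2 : ℝ) : ℂ))‖ *
                (((x.d₁ : ℝ) * (2 ^ x.i.1 * (1 / 2)) * ((x.d₂ : ℝ) * (2 ^ x.i.2 * (1 / 2)))) ^ (-(1 / 2 : ℝ)) *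
                  (((x.r + 1 : ℕ) : ℝ))⁻¹)) *
          ∑ q ∈ G.filter (fun q ↦ (q - N) / L = b),
            ‖e ((k : ℝ) * q / (2 * N + 1 : ℕ)) * (2 * (qhat q : ℂ) * (2 * π / q)) *
                (((Real.log (qhat q ^ Δ'))⁻¹ ^ (w.1 + w.2) : ℝ) : ℂ)‖)) := by
  have hD : ∀ r l m d₁ d₂ i h₁ s, D r l m d₁ d₂ i h₁ s ≠ 0 → |h₁| ≤ (N : ℤ) := fun r l m d₁ d₂ i h₁ s h ↦
    (hDH r l m d₁ d₂ i h₁ s h).trans (by exact_mod_cast hH)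
  have hG' : ∀ q ∈ G, q.Prime ∧ N < q ∧ q ≤ 2 * N := fun q hq ↦ ⟨(hG q hq).1, (hG q hq).2.2.1, (hG q hq).2.2.2.2⟩
  rw [coreWin_eq_sum_blocks_integral_family R hD T G hL hG hΔ hε₀, abs_neg]
  refine (Complex.abs_re_le_norm _).trans ?_
  refine norm_sum_le_of_le _ fun b hb ↦ norm_sum_le_of_le _ fun k _ ↦ norm_sum_le_of_le _ fun w _ ↦ ?_
  exact norm_integral_blockFamily_le R hR hN hH T G hL hLN hG' b Δ' ε₀ k w hJ hDH (hDρ b hb)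

end Summit.Parity.GeneralizedHardyLittlewood.Theorems.BeyondDiagonalBeatsQuarter.OffDiag
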